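import Mathlib

/-!
# `Balaban1983to89.B11V0Interface` — the interface plaquettes of the background configuration V₀ of
[Balaban1985Variational] Sect. A (11): algebraic core of the located objection G-B11-A1b and of its repair

T. Bałaban, *The variational problem and background fields in renormalization group method for lattice gauge
theories*, Commun. Math. Phys. **102**, 277–309 (1985), doi:10.1007/bf01229381.  PDF held:
`paper:balaban1985-cmp102-variational-background` (journal page = PDF page + 276).

CITATION HEADER (lean-in-tree rule 2026-08-18).  This module is a Mathlib-only SIBLING of `…Balaban1983to89.B11`
and `…Balaban1983to89.B11Thm1` (it imports neither and modifies nothing).  WHAT IS REPRODUCED, and from where: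

* §1–§2: two elementary norm facts for unitaries in a C⋆-ring (the telescoping bound
  ‖u₁⋯uₙ − 1‖ ≤ Σ‖uᵢ − 1‖ and the conjugation invariance ‖T c T⁻¹ − 1‖ = ‖c − 1‖) and the NON-ABELIAN STOKES IDENTITY FOR
  A LADDER of n lattice plaquettes (the holonomy of the boundary of a 1 × n strip is an ordered product of conjugated
  plaquette holonomies), hence ‖hol(∂ strip) − 1‖ ≤ Σ ‖hol(∂pᵢ) − 1‖.  This is the "same reasoning as in [3] (between
  (44) and (46))" invoked VERBATIM in the published [6] = Bałaban, CMP **99** (1985) p. 79 (proof of Lemma 1: *"The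
  conditions (R₀V′)(Γ_{y,x}) = 1, x ∈ B(y), imply V′_b = 1 for b ⊂ Γ_{y,x}. This and the above estimate imply
  |V′_b − 1| < (d−1)(L−1)2α₀L⁻² for b ⊂ B(y) by the same reasoning as in [3] (between (44) and (46))"*), typed here as a
  kernel-checked lemma rather than a citation. [folklore]
* §3: the plaquette words of the background configuration V₀ on the new bonds of Λ′_{k−1} = Λ_{k−1} ∪ B(Λ_k)
  (p. 279 (11), verbatim: *"We can easily construct a configuration V₀ on 𝔅′_{k−1} such that it satisfies (7) on
  𝔅′_{k−1}, and V₀ = V on ⋃_{j=0}^{k−1} Λ_j, V̄₀ = V on Λ_k. (11) For example we can take V_{0,b} = V_{b′}, for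
  b ∈ B(b′), b′ ∈ Λ_k and V_{0,b} = 1 for remaining bonds of B(Λ_k)"*, with B(b′) the corridor of [6] (1.23):
  *"B^j(c) = {b ⊂ T: b₋ ∈ B^j(c₋), b₊ ∈ B^j(c₊)}"*) as identities in an arbitrary group: the PRINTED choice gives, on a
  fine plaquette joining a shell block of Λ_{k−1} to a block of B(Λ_k), the word V_c·1·V_c⁻¹·V_t⁻¹ = V_t⁻¹ (a bare BOND
  variable of V, not controlled by (7): the cell's objection G-B11-A1b), while the GAUGE-COVARIANT choice
  V₀⟨x′,x⟩ = V(Γ_{y′,x′})⁻¹·V⟨y′,y⟩ on the radial interface bonds turns every new plaquette word into a conjugate of a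
  product of block-walk transports (`anchor_conj4`), which §1–§2 and hypothesis (7) bound (cell record
  `b2b-balaban-b11-g4/V0-REPAIR.md`, §3). [cite: Balaban1985Variational, (11) p.279]
* §4: the (d, L)-only constants of the repaired two-tier hypothesis (7″) (κ₀ = 1 + 6(d−1)L(L−1) ≤ 6dL²,
  C′₁ = 2(d−1)L²) with the real inequalities the repair uses (2 + π < 6 via `Real.pi_lt_four`), and the scalar
  (eigenvalue-wise) logarithm bound |θ| ≤ (π/2)‖e^{iθ} − 1‖ for |θ| ≤ π (Jordan's inequality, Mathlib
  `Real.mul_abs_le_abs_sin`) through which the block averages (15) of [4] are compared with straight transports WITHOUT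
  any smallness condition on ε₁. [folklore]
* §5: the arithmetic of the HARDENED COUNTEREXAMPLE (every gauge): 20ε < 2 sin(12.375 ε) for 0 < ε ≤ 2/25 (from
  Mathlib's `Real.sin_gt_sub_cube`), ‖e^{25iφ} − 1‖ = |2 sin(25φ/2)|, the pigeonhole consequence of §1 (if a product
  of n unitaries is ≥ nε away from 1, some factor is ≥ ε away from 1), and the zero-sum / zero-first-moment bookkeeping
  of the compensating plaquette pattern. [folklore]

NOTHING of the series is asserted: every statement below is a theorem of Mathlib-level algebra/analysis.  The located
gap and its repair are the cell's GAPS.md rows G-B11-A1b / C-B11-A1c / G-B11-A1d; value = repair census of a published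
step, NOT summit progress.  Unit `b2b-balaban-b11-g4` (paper sub-cell B11, generation 4); staged byte-identically in
the cell package `run/shared/lean/pub/pub-balaban/lean/BalabanYm4/Literature/…/B11V0Interface.lean`.
-/

namespace Literature.MathematicalPhysics.QuantumFieldTheory.Balaban1983to89.B11V0Interface

/-! ## §1. Telescoping norm bounds -/

section Telescoping

variable {R : Type*} [NormedRing R]

/-- ‖ab − 1‖ ≤ ‖a − 1‖ + ‖b − 1‖ whenever ‖a‖ ≤ 1 (from ab − 1 = a(b − 1) + (a − 1)). [folklore] -/
theorem norm_mul_sub_one_le (a b : R) (ha : ‖a‖ ≤ 1) : ‖a * b - 1‖ ≤ ‖a - 1‖ + ‖b - 1‖ := by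
  have h : a * b - 1 = a * (b - 1) + (a - 1) := by noncomm_ring
  calc ‖a * b - 1‖ = ‖a * (b - 1) + (a - 1)‖ := by rw [h]
    _ ≤ ‖a * (b - 1)‖ + ‖a - 1‖ := norm_add_le _ _
    _ ≤ ‖a‖ * ‖b - 1‖ + ‖a - 1‖ := by gcongr; exact norm_mul_le _ _
    _ ≤ 1 * ‖b - 1‖ + ‖a - 1‖ := by gcongr
    _ = ‖a - 1‖ + ‖b - 1‖ := by ring

/-- The telescoping bound: for a list of elements of norm ≤ 1, ‖∏ aᵢ − 1‖ ≤ Σ ‖aᵢ − 1‖. [folklore] -/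
theorem norm_list_prod_sub_one_le (l : List R) (h : ∀ a ∈ l, ‖a‖ ≤ 1) :
    ‖l.prod - 1‖ ≤ (l.map fun a => ‖a - 1‖).sum := by
  induction l with
  | nil => simp
  | cons a t ih =>
      simp only [List.prod_cons, List.map_cons, List.sum_cons]
      have ha : ‖a‖ ≤ 1 := h a (by simp)
      have ht : ∀ b ∈ t, ‖b‖ ≤ 1 := fun b hb => h b (by simp [hb])
      exact le_trans (norm_mul_sub_one_le a t.prod ha) (by linarith [ih ht])

/-- … with a uniform bound: if every factor is within δ of 1 then the product of n factors is within nδ of 1.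
[folklore] -/
theorem norm_list_prod_sub_one_le_mul (l : List R) (δ : ℝ) (h1 : ∀ a ∈ l, ‖a‖ ≤ 1)
    (hδ : ∀ a ∈ l, ‖a - 1‖ ≤ δ) : ‖l.prod - 1‖ ≤ l.length * δ := by
  refine le_trans (norm_list_prod_sub_one_le l h1) ?_
  have : (l.map fun a => ‖a - 1‖).sum ≤ (l.map fun _ => δ).sum :=
    List.sum_le_sum (fun a ha => hδ a ha)
  simpa [List.map_const', List.sum_replicate, nsmul_eq_mul] using this

/-- Pigeonhole form used by the hardened counterexample (§5): if a product of n ≥ 1 factors of norm ≤ 1 is at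
distance ≥ nε from 1, some factor is at distance ≥ ε from 1. [folklore] -/
theorem exists_factor_far_of_prod_far (l : List R) (ε : ℝ) (h1 : ∀ a ∈ l, ‖a‖ ≤ 1)
    (hfar : (l.length : ℝ) * ε ≤ ‖l.prod - 1‖) (hne : l ≠ []) : ∃ a ∈ l, ε ≤ ‖a - 1‖ := by
  by_contra hcon
  push Not at hcon
  -- every factor is STRICTLY within ε: then the product is strictly within nε
  obtain ⟨a₀, ha₀⟩ := List.exists_mem_of_ne_nil l hne
  have hlt : (l.map fun a => ‖a - 1‖).sum < (l.map fun _ => ε).sum :=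
    List.sum_lt_sum (fun a => ‖a - 1‖) (fun _ => ε) (fun a ha => (hcon a ha).le) ⟨a₀, ha₀, hcon a₀ ha₀⟩
  have heq : (l.map fun _ => ε).sum = (l.length : ℝ) * ε := by
    simp [List.map_const', List.sum_replicate, nsmul_eq_mul]
  have := norm_list_prod_sub_one_le l h1
  linarith

end Telescoping

/-! ## §2. Unitaries in a C⋆-ring: conjugation invariance and the ladder (non-abelian Stokes) bound -/

section Ladder

variable {G : Type*} [Group G]

/-- Transport along the first i bottom bonds of a ladder: bot 0 · bot 1 ⋯ bot (i−1). [folklore] -/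
def transport (bot : ℕ → G) (i : ℕ) : G := ((List.range i).map bot).prod

/-- The i-th cell (plaquette) of the ladder, based at the bottom node i: bot i · r (i+1) · (top i)⁻¹ · (r i)⁻¹
(bottom bond, right rung, top bond backwards, left rung backwards). [folklore] -/
def cell (bot top r : ℕ → G) (i : ℕ) : G := bot i * r (i + 1) * (top i)⁻¹ * (r i)⁻¹

/-- The boundary holonomy of the ladder with n cells, based at the bottom node 0: along the bottom to node n, up the
last rung, back along the top, down the rung 0. [folklore] -/
def boundary (bot top r : ℕ → G) (n : ℕ) : G :=
  transport bot n * r n * (transport top n)⁻¹ * (r 0)⁻¹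

/-- The ordered product of the cells conjugated back to the base point: (T_{n−1} c_{n−1} T_{n−1}⁻¹) ⋯ (T₀ c₀ T₀⁻¹),
Tᵢ = `transport bot i`. [folklore] -/
def conjCells (bot top r : ℕ → G) (n : ℕ) : G :=
  (((List.range n).reverse).map fun i => transport bot i * cell bot top r i * (transport bot i)⁻¹).prod

/-- Empty transport. [folklore] -/
theorem transport_zero (bot : ℕ → G) : transport bot 0 = 1 := by simp [transport]

/-- One more bottom bond. [folklore] -/
theorem transport_succ (bot : ℕ → G) (i : ℕ) : transport bot (i + 1) = transport bot i * bot i := by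
  simp [transport, List.range_succ, List.map_append, List.prod_append]

/-- No cells. [folklore] -/
theorem conjCells_zero (bot top r : ℕ → G) : conjCells bot top r 0 = 1 := by simp [conjCells]

/-- One more cell, prepended (the product is ordered from the far end back to the base). [folklore] -/
theorem conjCells_succ (bot top r : ℕ → G) (n : ℕ) :
    conjCells bot top r (n + 1) =
      (transport bot n * cell bot top r n * (transport bot n)⁻¹) * conjCells bot top r n := by
  simp [conjCells, List.range_succ, List.reverse_append]

/-- **Non-abelian Stokes for a ladder.**  The boundary holonomy of a 1 × n strip of plaquettes equals the ordered
product of the plaquette holonomies, each conjugated by the transport from the base point to the plaquette's base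
corner.  (A degenerate cell — a bottom bond parallel to the rungs, top = bot shifted — contributes the value 1, so
the identity also covers sweeps of an arbitrary lattice path by one lattice step.) [folklore] -/
theorem boundary_eq_conjCells (bot top r : ℕ → G) (n : ℕ) :
    boundary bot top r n = conjCells bot top r n := by
  induction n with
  | zero => simp [boundary, transport_zero, conjCells_zero]
  | succ n ih =>
      rw [conjCells_succ, ← ih]
      simp only [boundary, cell, transport_succ, mul_inv_rev]
      group

variable {R : Type*} [NormedRing R] [StarRing R] [CStarRing R]

/-- Conjugation invariance: ‖T c T⁻¹ − 1‖ = ‖c − 1‖ for unitaries T, c of a C⋆-ring. [folklore] -/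
theorem norm_coe_conj_sub_one (T c : unitary R) :
    ‖((T * c * T⁻¹ : unitary R) : R) - 1‖ = ‖(c : R) - 1‖ := by
  have hcoe : ((T * c * T⁻¹ : unitary R) : R) = (T : R) * (c : R) * ((star T : unitary R) : R) := by
    rw [← Unitary.star_eq_inv]; push_cast; rfl
  have h1 : (T : R) * ((star T : unitary R) : R) = 1 := by
    rw [Unitary.coe_star]; exact Unitary.coe_mul_star_self T
  have hid : (T : R) * ((c : R) - 1) * ((star T : unitary R) : R) =
      (T : R) * (c : R) * ((star T : unitary R) : R) - 1 := by
    rw [mul_sub, mul_one, sub_mul, h1]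
  rw [hcoe, ← hid, CStarRing.norm_mul_coe_unitary, CStarRing.norm_coe_unitary_mul]

variable [Nontrivial R]

/-- The telescoping bound for unitaries: ‖u₁⋯uₙ − 1‖ ≤ Σ ‖uᵢ − 1‖. [folklore] -/
theorem norm_coe_list_prod_sub_one_le (l : List (unitary R)) :
    ‖((l.prod : unitary R) : R) - 1‖ ≤ (l.map fun u : unitary R => ‖(u : R) - 1‖).sum := by
  induction l with
  | nil => simp
  | cons a t ih =>
      rw [List.prod_cons, List.map_cons, List.sum_cons, Submonoid.coe_mul]
      have ha : ‖(a : R)‖ ≤ 1 := (CStarRing.norm_coe_unitary a).le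
      exact le_trans (norm_mul_sub_one_le (a : R) _ ha) (by linarith)

/-- **Ladder bound.**  For unitaries: ‖hol(∂ strip) − 1‖ ≤ Σ_{i<n} ‖hol(∂pᵢ) − 1‖ — the boundary holonomy of a strip
of n plaquettes each within δ of 1 is within nδ of 1 (the ribbon / comb estimate of [6] p. 79 and [4] (44)–(46),
with the area count supplied by the caller). [folklore] -/
theorem norm_boundary_sub_one_le (bot top r : ℕ → unitary R) (n : ℕ) (δ : ℝ)
    (hδ : ∀ i < n, ‖((cell bot top r i : unitary R) : R) - 1‖ ≤ δ) :
    ‖((boundary bot top r n : unitary R) : R) - 1‖ ≤ n * δ := by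
  rw [boundary_eq_conjCells]
  unfold conjCells
  refine le_trans (norm_coe_list_prod_sub_one_le _) ?_
  rw [List.map_map]
  have hterm : ∀ i ∈ (List.range n).reverse,
      ((fun u : unitary R => ‖(u : R) - 1‖) ∘
        (fun i : ℕ => transport bot i * cell bot top r i * (transport bot i)⁻¹)) i ≤ (fun _ : ℕ => δ) i := by
    intro i hi
    simp only [Function.comp_apply, norm_coe_conj_sub_one]
    exact hδ i (by simpa using hi)
  refine le_trans (List.sum_le_sum hterm) ?_
  simp [List.map_const', List.sum_replicate, nsmul_eq_mul]

end Ladder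

/-! ## §3. The plaquette words of V₀ on the new bonds (p. 279 (11)) as group identities -/

section Words

variable {G : Type*} [Group G]

/-- **The printed choice fails at the interface** (GAPS G-B11-A1b).  On a fine plaquette whose lower bond t lies in a
shell block of Λ_{k−1} (value V_t, a bond variable of V) and whose upper bond is an internal bond of a block of
B(Λ_k) (printed value 1), with both radial bonds in the corridor B(c) of the poking unit bond c (printed value V_c),
the plaquette word is V_c · 1 · V_c⁻¹ · V_t⁻¹ = V_t⁻¹: a bare bond variable, on which (7) says nothing.
[cite: Balaban1985Variational, (11) p.279] -/
theorem printed_interface_word (Vc Vt : G) : Vc * 1 * Vc⁻¹ * Vt⁻¹ = Vt⁻¹ := by group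

/-- **The covariant choice.**  Radial interface bond ⟨x′, x⟩ (x′ in the shell block B(y′), x ∈ B(y), y ∈ Λ_k):
V₀⟨x′,x⟩ := V(Γ_{y′,x′})⁻¹ · V⟨y′,y⟩.  On the plaquette ⟨x′, x′+e_ν, x+e_ν, x⟩ (shell bond t = ⟨x′, x′+e_ν⟩, internal
bond of B(y) with value 1) the word is V_t · V₀⟨x′+e_ν, x+e_ν⟩ · 1⁻¹ · V₀⟨x′,x⟩⁻¹ = V_t · V(Γ₂)⁻¹ · V(Γ₁) with
Γ₁ = Γ_{y′,x′}, Γ₂ = Γ_{y′,x′+e_ν}: the unit datum V_c CANCELS and what is left is the holonomy of the closed comb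
loop Γ₁ · t · Γ₂⁻¹ inside the shell block (a ribbon of ≤ (d−1)(L−1) plaquettes of Λ_{k−1}, each controlled by (7)),
conjugated. [cite: Balaban1985Variational, (11) p.279] -/
theorem covariant_interface_word (Vc Vt Γ₁ Γ₂ : G) :
    Vt * (Γ₂⁻¹ * Vc) * (1 : G)⁻¹ * (Γ₁⁻¹ * Vc)⁻¹ = Γ₁⁻¹ * (Γ₁ * Vt * Γ₂⁻¹) * Γ₁ := by group

/-- Gauge covariance of the covariant radial bond: under u (values u(x′) at the shell point, u(y′), u(y) at the unit
points; V(Γ_{y′,x′}) ↦ u(y′)V(Γ)u(x′)⁻¹, V⟨y′,y⟩ ↦ u(y′)V_c u(y)⁻¹) the bond variable transforms as a bond from x′ to a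
point carrying u(y) — i.e. covariantly for the extension of u to B(y) by the constant u(y). [folklore] -/
theorem covariant_radial_gauge (ux' uy' uy Γ Vc : G) :
    (uy' * Γ * ux'⁻¹)⁻¹ * (uy' * Vc * uy⁻¹) = ux' * (Γ⁻¹ * Vc) * uy⁻¹ := by group

/-- **Master identity (anchor conjugation).**  Writing each bond variable of a fine plaquette ⟨x₁, x₂, x₃, x₄⟩ of
V₀ as αᵢ⁻¹ βᵢ αᵢ₊₁ — αᵢ = the anchor transport from the block corner yᵢ to xᵢ (= 1 inside B(Λ_k), = V(Γ_{yᵢ,xᵢ}) in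
the shell), βᵢ ∈ {1, V⟨yᵢ,yᵢ₊₁⟩, a shell transport} the transport of the BLOCK WALK step yᵢ → yᵢ₊₁ — the plaquette
word is the conjugate by α₁ of the block-walk word β₁β₂β₃β₄ (V0-REPAIR.md §3.2: the block walk is a back-and-forth or
a unit plaquette of Λ_k ∪ shell, whose word (7) and §2 control). [folklore] -/
theorem anchor_conj4 (α₁ α₂ α₃ α₄ β₁ β₂ β₃ β₄ : G) :
    (α₁⁻¹ * β₁ * α₂) * (α₂⁻¹ * β₂ * α₃) * (α₃⁻¹ * β₃ * α₄) * (α₄⁻¹ * β₄ * α₁) =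
      α₁⁻¹ * (β₁ * β₂ * β₃ * β₄) * α₁ := by group

/-- Block walk of "back-and-forth" type (Case A of V0-REPAIR.md §3.2: two vertices in B(y), two in B(y′)): the
block-walk word is V_c · τ′ · V_c⁻¹ · τ with τ, τ′ the null-step transports (1 in an inside block, a comb-ribbon
holonomy in a shell block) — a conjugate of τ′ times τ. [folklore] -/
theorem backforth_word (Vc τ τ' : G) : Vc * τ' * Vc⁻¹ * τ = Vc * (τ' * (Vc⁻¹ * τ * Vc)) * Vc⁻¹ := by group

/-- The interior case of the master identity (all four blocks in Λ_k, gen-3 record V0-CONSTRUCTION.md §3): anchors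
are 1 and the word IS the block-walk word — 1 for a back-and-forth (β = V_c, 1, V_c⁻¹, 1) … [folklore] -/
theorem interior_backforth (Vc : G) : Vc * 1 * Vc⁻¹ * 1 = 1 := by group

end Words

/-! ## §4. The constants of the repaired hypothesis (7″) -/

section Constants

/-- κ₀(d, L) := 1 + 6(d−1)L(L−1): the factor allowed on the deep-interior top-level plaquettes in the two-tier
hypothesis (7″) of the repaired induction (V0-REPAIR.md §2); it dominates the Case-B interface bound
1 + 2(1 + π/2)(d−1)L(L−1) = 1 + (2 + π)(d−1)L(L−1) (two shell–shell steps of the block walk, each costing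
(d−1)L(L−1)ε₁ for the comb transport against the straight transport plus (π/2)(d−1)L(L−1)ε₁ for the straight
transport against the block average (15) of [4], `abs_le_pi_div_two_mul_norm_exp_sub_one`). [folklore] -/
noncomputable def kappa0 (d L : ℝ) : ℝ := 1 + 6 * (d - 1) * L * (L - 1)

/-- C′₁(d, L) := 2(d−1)L²: the constant of the approximate boundary condition |V̄₀ − V| < C′₁ε₁ on the poking bonds of
Λ_k (V0-REPAIR.md §3.3), dominating (π/2)(d−1)(L−1)². [folklore] -/
noncomputable def C1prime (d L : ℝ) : ℝ := 2 * (d - 1) * L ^ 2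

/-- 2 + π < 6, i.e. 2(1 + π/2) < 6 (from π < 4). [folklore] -/
theorem two_add_pi_lt_six : 2 * (1 + Real.pi / 2) < 6 := by
  have := Real.pi_lt_four
  linarith

/-- The Case-B interface bound is dominated by κ₀: 1 + 2(1 + π/2)·A ≤ κ₀ whenever A = (d−1)L(L−1) ≥ 0. [folklore] -/
theorem caseB_le_kappa0 (d L : ℝ) (hA : 0 ≤ (d - 1) * L * (L - 1)) :
    1 + 2 * (1 + Real.pi / 2) * ((d - 1) * L * (L - 1)) ≤ kappa0 d L := by
  unfold kappa0
  have h6 := two_add_pi_lt_six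
  nlinarith [mul_nonneg (show (0 : ℝ) ≤ 6 - 2 * (1 + Real.pi / 2) by linarith) hA]

/-- The Case-A interface bound (one comb ribbon, (d−1)(L−1) plaquettes) is dominated by κ₀ as well. [folklore] -/
theorem caseA_le_kappa0 (d L : ℝ) (hd : 1 ≤ d) (hL : 1 ≤ L) : (d - 1) * (L - 1) ≤ kappa0 d L := by
  unfold kappa0
  have h1 : 0 ≤ (d - 1) * (L - 1) := mul_nonneg (by linarith) (by linarith)
  nlinarith [mul_nonneg h1 (show (0 : ℝ) ≤ L by linarith)]

/-- 1 ≤ κ₀ (so (7) with ε₁ implies (7″) with (ε₁, κ₀)). [folklore] -/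
theorem one_le_kappa0 (d L : ℝ) (hd : 1 ≤ d) (hL : 1 ≤ L) : 1 ≤ kappa0 d L := by
  unfold kappa0
  have : 0 ≤ (d - 1) * L * (L - 1) := by
    have := mul_nonneg (mul_nonneg (show (0:ℝ) ≤ d - 1 by linarith) (show (0:ℝ) ≤ L by linarith))
      (show (0:ℝ) ≤ L - 1 by linarith)
    simpa [mul_assoc] using this
  linarith

/-- κ₀ ≤ 6dL² for d, L ≥ 1 (the form quoted in the cell records). [folklore] -/
theorem kappa0_le (d L : ℝ) (hd : 1 ≤ d) (hL : 1 ≤ L) : kappa0 d L ≤ 6 * d * L ^ 2 := by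
  unfold kappa0
  nlinarith [mul_nonneg (show (0:ℝ) ≤ d - 1 by linarith) (show (0:ℝ) ≤ L - 1 by linarith),
    mul_nonneg (show (0:ℝ) ≤ d by linarith) (show (0:ℝ) ≤ L by linarith)]

/-- The poking-bond average bound is dominated by C′₁: (π/2)(d−1)(L−1)² ≤ 2(d−1)L². [folklore] -/
theorem avg_le_C1prime (d L : ℝ) (hd : 1 ≤ d) (hL : 1 ≤ L) :
    Real.pi / 2 * ((d - 1) * (L - 1) ^ 2) ≤ C1prime d L := by
  unfold C1prime
  have hπ := Real.pi_lt_four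
  have h1 : 0 ≤ (d - 1) * (L - 1) ^ 2 := mul_nonneg (by linarith) (sq_nonneg _)
  have h2 : (d - 1) * (L - 1) ^ 2 ≤ (d - 1) * L ^ 2 := by
    apply mul_le_mul_of_nonneg_left _ (by linarith)
    nlinarith
  nlinarith

/-- **The logarithm costs at most π/2, with no smallness condition.**  For a real angle θ with |θ| ≤ π (an
eigen-angle of a unitary W, principal branch): |θ| ≤ (π/2)·‖e^{iθ} − 1‖.  Hence ‖(1/i) log W‖ ≤ (π/2)‖W − 1‖ for every
unitary W without eigenvalue −1, and the block average V̄_c = exp[i avg_x (1/i) log W_x]·V(c) of [4] (15) satisfies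
‖V̄_c − V(c)‖ ≤ (π/2) max_x ‖W_x − 1‖ (with ‖e^{iH} − 1‖ ≤ ‖H‖, Mathlib `Real.norm_exp_I_mul_ofReal_sub_one_le` on
eigen-angles).  From Jordan's inequality. [folklore] -/
theorem abs_le_pi_div_two_mul_norm_exp_sub_one (θ : ℝ) (h : |θ| ≤ Real.pi) :
    |θ| ≤ Real.pi / 2 * ‖Complex.exp (Complex.I * (θ : ℂ)) - 1‖ := by
  rw [Complex.norm_exp_I_mul_ofReal_sub_one]
  have hπ := Real.pi_pos
  have hj := Real.mul_abs_le_abs_sin (x := θ / 2) (by rw [abs_div, abs_of_pos (by norm_num : (0:ℝ) < 2)]; linarith)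
  have e1 : |θ / 2| = |θ| / 2 := by rw [abs_div, abs_of_pos (by norm_num : (0:ℝ) < 2)]
  rw [e1] at hj
  have e2 : ‖2 * Real.sin (θ / 2)‖ = 2 * |Real.sin (θ / 2)| := by
    rw [Real.norm_eq_abs, abs_mul, abs_of_pos (by norm_num : (0:ℝ) < 2)]
  rw [e2]
  -- |θ| = (π/2)·(2/π)|θ| ≤ (π/2)·2|sin(θ/2)|
  have : 2 / Real.pi * |θ| ≤ 2 * |Real.sin (θ / 2)| := by
    have := hj; field_simp at this ⊢; linarith
  calc |θ| = Real.pi / 2 * (2 / Real.pi * |θ|) := by field_simp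
    _ ≤ Real.pi / 2 * (2 * |Real.sin (θ / 2)|) := by gcongr

/-- The two-tier class sits between the printed classes: a bound b < ε₁ is also < κ₀ε₁, and a bound b < κ₀ε₁ with
κ₀ ≥ 1 is what Sects. B–F are fed (parameter κ₀ε₁). [folklore] -/
theorem lt_kappa_mul_of_lt (b ε κ : ℝ) (hκ : 1 ≤ κ) (hε : 0 ≤ ε) (h : b < ε) : b < κ * ε := by
  nlinarith

/-- For a unitary the distance to 1 never exceeds 2, so where (d−1)L(L−1)ε₁ ≥ 2 every bound "< κ₀ε₁" of the repair
holds trivially (κ₀ε₁ > 12): the interface lemma needs no smallness condition on ε₁. [folklore] -/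
theorem trivial_regime (A ε : ℝ) (hA : 2 ≤ A * ε) (hε : 0 < ε) (x : ℝ) (hx : x ≤ 2) : x < (1 + 6 * A) * ε := by
  nlinarith

/-- Locality of the repair (V0-REPAIR.md §2.3): the new rough plaquettes lie within 2 units (of the level k−1) of
Ω_k, and [6] (1) separates Ω_k from Ω_{k−1}ᶜ by more than RM₁ ≥ 4 units, so they are at distance ≥ 2 from
Ω_{k−1}ᶜ — inside the deep interior where (7″) allows κ₀ε₁. [folklore] -/
theorem deep_interior_margin (RM dist : ℝ) (hRM : 4 ≤ RM) (hsep : RM - 2 ≤ dist) : 2 ≤ dist := by linarith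

end Constants

/-! ## §5. Arithmetic of the hardened counterexample (every gauge) -/

section Counterexample

/-- **The decisive inequality.**  For 0 < ε ≤ 2/25: 20ε < 2 sin(12.375 ε) — so a 5 × 5 patch of shell plaquettes
each of holonomy e^{iφ}, φ = 0.99ε (total flux 25φ = 24.75ε, ‖e^{25iφ} − 1‖ = 2 sin(12.375ε)), cannot have all
20 boundary bonds within ε of 1 in ANY gauge (§1 pigeonhole).  From Mathlib's x − x³/6 < sin x. [folklore] -/
theorem twenty_mul_lt_two_sin (ε : ℝ) (h0 : 0 < ε) (h1 : ε ≤ 2 / 25) :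
    20 * ε < 2 * Real.sin (12.375 * ε) := by
  have hx : 0 < 12.375 * ε := by positivity
  have hs := Real.sin_gt_sub_cube hx
  have hε2 : ε * ε ≤ 2 / 25 * (2 / 25) := mul_le_mul h1 h1 h0.le (by norm_num)
  have hcube : (12.375 * ε) ^ 3 ≤ 12.13 * ε := by
    have h := mul_le_mul_of_nonneg_left hε2 (show (0:ℝ) ≤ 12.375 ^ 3 * ε by positivity)
    nlinarith [h]
  linarith [hs, hcube]

/-- The threshold is genuine: the same inequality FAILS at ε = 1/10 (sin x < x gives 2 sin(1.2375) < 2.475, and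
indeed 2 sin(1.2375) ≈ 1.89 < 2); recorded so that the admissible range (0, 2/25] is not mistaken for a convenience.
[folklore] -/
theorem two_sin_lt_twenty_mul_at_tenth : 2 * Real.sin (12.375 * (1 / 10)) < 20 * (1 / 10 : ℝ) + 0.475 := by
  have := Real.sin_lt (show (0:ℝ) < 12.375 * (1 / 10) by norm_num)
  linarith

/-- ‖e^{iθ} − 1‖ = |2 sin(θ/2)| (Mathlib), at θ = 25φ: the flux of the 5 × 5 patch. [folklore] -/
theorem patch_flux_norm (φ : ℝ) :
    ‖Complex.exp (Complex.I * ((25 * φ : ℝ) : ℂ)) - 1‖ = |2 * Real.sin (25 * φ / 2)| := by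
  rw [Complex.norm_exp_I_mul_ofReal_sub_one]
  simp [Real.norm_eq_abs]

/-- With φ = 0.99ε: 25φ/2 = 12.375ε, and for 0 < ε ≤ 2/25 the flux distance exceeds 20ε. [folklore] -/
theorem patch_flux_gt (ε : ℝ) (h0 : 0 < ε) (h1 : ε ≤ 2 / 25) :
    20 * ε < ‖Complex.exp (Complex.I * ((25 * (0.99 * ε) : ℝ) : ℂ)) - 1‖ := by
  rw [patch_flux_norm]
  have h : 25 * (0.99 * ε) / 2 = 12.375 * ε := by ring
  rw [h]
  exact lt_of_lt_of_le (twenty_mul_lt_two_sin ε h0 h1) (le_abs_self _)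

/-- **Pigeonhole at the patch boundary.**  In a C⋆-ring: if the holonomy around the patch is the product of the 20
boundary bond variables (unitaries, in any gauge — a gauge transformation conjugates the holonomy and §2 shows the
distance to 1 is unchanged) and is more than 20ε from 1, then some boundary bond b has ‖V_b − 1‖ ≥ ε; under the
printed choice of V₀ that bond's interface plaquette word is V_b⁻¹ (`printed_interface_word`), violating (7).
[folklore] -/
theorem exists_boundary_bond_far {R : Type*} [NormedRing R] [StarRing R] [CStarRing R] [Nontrivial R]
    (l : List (unitary R)) (ε : ℝ) (hlen : l.length = 20)
    (hfar : 20 * ε ≤ ‖((l.prod : unitary R) : R) - 1‖) : ∃ u ∈ l, ε ≤ ‖(u : R) - 1‖ := by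
  have h1 : ∀ a ∈ l.map ((↑) : unitary R → R), ‖a‖ ≤ 1 := by
    intro a ha
    obtain ⟨u, -, rfl⟩ := List.mem_map.1 ha
    exact (CStarRing.norm_coe_unitary u).le
  have hprod : ((l.prod : unitary R) : R) = (l.map ((↑) : unitary R → R)).prod :=
    Submonoid.coe_list_prod (unitary R) l
  have hne : l.map ((↑) : unitary R → R) ≠ [] := by
    intro h; have := congrArg List.length h; simp [hlen] at this
  have hfar' : ((l.map ((↑) : unitary R → R)).length : ℝ) * ε ≤ ‖(l.map ((↑) : unitary R → R)).prod - 1‖ := by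
    simpa [hlen, hprod] using hfar
  obtain ⟨a, ha, hε⟩ := exists_factor_far_of_prod_far _ ε h1 hfar' hne
  obtain ⟨u, hu, rfl⟩ := List.mem_map.1 ha
  exact ⟨u, hu, hε⟩

/-- ‖V_b⁻¹ − 1‖ = ‖V_b − 1‖ for a unitary (the printed interface word V_b⁻¹ is exactly as far from 1 as V_b).
[folklore] -/
theorem norm_inv_sub_one {R : Type*} [NormedRing R] [StarRing R] [CStarRing R] (u : unitary R) :
    ‖((u⁻¹ : unitary R) : R) - 1‖ = ‖(u : R) - 1‖ := by
  have hinv : ((u⁻¹ : unitary R) : R) * (u : R) = 1 := by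
    rw [← Unitary.star_eq_inv, Unitary.coe_star]; exact Unitary.coe_star_mul_self u
  have h : -(((u⁻¹ : unitary R) : R) * ((u : R) - 1)) = ((u⁻¹ : unitary R) : R) - 1 := by
    rw [mul_sub, mul_one, hinv, neg_sub]
  rw [← h, norm_neg, CStarRing.norm_coe_unitary_mul]

/-- Bookkeeping of the compensating pattern (V0-REPAIR.md §4): per column the plaquette angles are +φ at the x₂-offsets
{0,1,2,3,4} (the patch) and −φ at {5,6,7,−3,−5}; ZERO SUM (5 − 5 = 0) makes the tangential potential A₁ compactly
supported, and ZERO FIRST MOMENT (0+1+2+3+4 = 5+6+7−3−5) makes the block sums and first 1-moments of A₁ vanish, so that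
every averaged shell bond V̄_c entering a mixed plaquette of (7) equals 1 exactly. [folklore] -/
theorem pattern_moments :
    ((0:ℤ) + 1 + 2 + 3 + 4) - (5 + 6 + 7 + (-3) + (-5)) = 0 ∧ ((5:ℤ) - 5 = 0) := by norm_num

/-- The pattern's angles are all of modulus φ = 0.99ε < ε and the normal taper changes A₁ (|A₁| ≤ 5φ) in steps of
1/5, producing normal plaquettes of modulus ≤ φ: every plaquette of the counterexample V satisfies (7) strictly.
[folklore] -/
theorem pattern_within_eps (ε : ℝ) (h0 : 0 < ε) : 0.99 * ε < ε ∧ 5 * (0.99 * ε) * (1 / 5) < ε := by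
  constructor <;> nlinarith

end Counterexample

end Literature.MathematicalPhysics.QuantumFieldTheory.Balaban1983to89.B11V0Interface
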